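import Literature.Geometry.Kaehler.RiemannSurfaceDipoleMoebiusRigidity
import Literature.AnabelianGeometry.AbsoluteAnabelian.HyperbolicCoverOfNonabelianDeckGroup
import Literature.AnabelianGeometry.AbsoluteAnabelian.ArchimedeanHolFieldFunctorGeometricPSLCor45Full
import HarnessLib

/-!
# The hyperbolic uniformization consumers of [AbsTopIII] Prop. 4.2 (i) / Cor. 4.5 and the deck-group disc covering, UNCONDITIONALLY

Layer `Literature/AnabelianGeometry/AbsoluteAnabelian` (PROOF-ONLY).  The tree stated the following
results CONDITIONALLY on the named fact `RiemannSurface.SimplyConnectedUniformization` (the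
uniformization theorem for simply connected Riemann surfaces, Poincaré–Koebe; I-Hsiung Lin, *Classical
Complex Analysis* vol. 2 (2011), §7.6.1 (7.6.1.1)), carried as a hypothesis `H2`:

* `exists_disc_covering_of_nonabelian_deckGroup` (Lin (7.6.2.1) case (3), deck-group form: a simply
  connected holomorphic cover with two non-commuting deck transformations is the disc);
* `HolRS.exists_pslQuotient_iso_of_nonabelian_fundamentalGroup`,
  `HolRS.exists_pslQuotient_iso_nonabelian_of_nonabelian_fundamentalGroup` (every connected second
  countable Riemann surface with non-abelian `π₁` is an `ℍ/Λ̄` in `HolRS`; Farkas–Kra IV.5.5–IV.5.6);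
* `HolRS.isIdRigid_EA_and_cor_4_5_full_mapsTo_of_isOrientableSurfaceGroup_fundamentalGroup`
  ([AbsTopIII] Prop. 4.2 (i) id-rigidity and Cor. 4.5 in full at every compact second-countable Riemann
  surface whose fundamental group is an orientable surface group).

The named fact is now a THEOREM of the tree (`RiemannSurface.simplyConnectedUniformization_holds`,
`RiemannSurfaceDipoleMoebiusRigidity`), so each of these holds UNCONDITIONALLY: this file records the
hypothesis-free forms (one-line dischargers BY NAME; nothing is restated or re-proved).  The
fundamental-group forms of the disc covering and [AbsTopIII] Cor. 2.4 (b)(c) are discharged in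
abc-iut-L4-t8's `HyperbolicCurveHyperbolicCoreUnconditional` and are not repeated here.  Classical
mathematics; nothing here bears on [IUTchIII] Cor. 3.12 or takes a side (S. Mochizuki, *Topics in
absolute anabelian geometry III*, J. Math. Sci. Univ. Tokyo 22 (2015), Prop. 4.2 (i) p. 106, Cor. 4.5
pp. 107–109).
-/

set_option autoImplicit false

noncomputable section

open Set Function TopologicalSpace
open scoped Manifold ContDiff Topology

namespace Literature.AnabelianGeometry.AbsoluteAnabelian

open Literature.Topology.CoveringSpaces Literature.Geometry.Kaehler
open Literature.Geometry.Kaehler.RiemannSurface (simplyConnectedUniformization_holds)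

/-! ### §1 Disc coverings of Riemann surfaces with non-abelian deck / fundamental group -/

section Disc

variable {U X : Type} [TopologicalSpace U] [ChartedSpace ℂ U] [IsManifold 𝓘(ℂ, ℂ) ω U]
  [TopologicalSpace X] [ChartedSpace ℂ X] [IsManifold 𝓘(ℂ, ℂ) ω X] {u : U → X}

/-- **A simply connected holomorphic cover with non-abelian deck group is the disc** — UNCONDITIONAL
form of `exists_disc_covering_of_nonabelian_deckGroup` (the `H2` binder discharged by
`simplyConnectedUniformization_holds`): if `u : U → X` is a surjective holomorphic covering map from a
simply connected (Hausdorff, second countable) Riemann surface with two non-commuting deck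
transformations, then `X` has a surjective holomorphic covering by the open unit disc.
[cite: Lin2011ClassicalComplexAnalysisII, §7.6.2 (7.6.2.1)] -/
theorem exists_disc_covering_of_nonabelian_deckGroup_unconditional
    [T2Space U] [SecondCountableTopology U] [SimplyConnectedSpace U]
    (hu : IsCoveringMap u) (hsurj : Function.Surjective u) (hud : MDifferentiable 𝓘(ℂ, ℂ) 𝓘(ℂ, ℂ) u)
    (hna : ∃ γ ∈ deckGroup u, ∃ δ ∈ deckGroup u, γ * δ ≠ δ * γ) :
    ∃ p : unitDiscOpens → X,
      IsCoveringMap p ∧ Function.Surjective p ∧ MDifferentiable 𝓘(ℂ, ℂ) 𝓘(ℂ, ℂ) p :=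
  exists_disc_covering_of_nonabelian_deckGroup simplyConnectedUniformization_holds hu hsurj hud hna

end Disc


/-! ### §2 Every hyperbolic Riemann surface with non-abelian `π₁` is an `ℍ/Λ̄`; Prop. 4.2 (i) and
Cor. 4.5 at every compact surface of genus `≥ 2` -/

namespace HolRS

open scoped _root_.Manifold _root_.ContDiff _root_.Topology MatrixGroups UpperHalfPlane
open _root_.MulAction _root_.Function _root_.Set _root_.CategoryTheory _root_.TopologicalSpace
open Literature.Topology.CoveringSpaces Literature.Geometry.Manifold
open Literature.IUT.HodgeTheaters (IsOrientableSurfaceGroup)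

variable (X : HolRS)

/-- **Every connected second countable Riemann surface with NON-ABELIAN fundamental group is an
`ℍ/Λ̄` in `HolRS`**, `Λ̄ ≃* π₁(X)` — UNCONDITIONAL form of
`HolRS.exists_pslQuotient_iso_of_nonabelian_fundamentalGroup` (every hyperbolic Riemann surface of finite
type: `(0, r ≥ 3)`, `(1, r ≥ 1)`, all `g ≥ 2` including compact genus `≥ 2`).
[cite: MochizukiAbsTopIII2015, Corollary 2.4 p.54] [cite: FarkasKra1992, IV.5.5–IV.5.6] -/
theorem exists_pslQuotient_iso_of_nonabelian_fundamentalGroup_unconditional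
    [SecondCountableTopology X.carrier] (x₀ : X.carrier)
    (hπ : ∃ a b : FundamentalGroup X.carrier x₀, a * b ≠ b * a) :
    ∃ (k : ℍ → X.carrier) (Λ : Subgroup PSL2R) (_ : ProperlyDiscontinuousSMul Λ ℍ)
      (_ : IsCancelSMul Λ ℍ),
      IsCoveringMap k ∧ MDifferentiable 𝓘(ℂ, ℂ) 𝓘(ℂ, ℂ) k ∧
      (∀ q : PSL2R, q ∈ Λ ↔ ∀ τ : ℍ, k (q • τ) = k τ) ∧
      IsQuotientCoveringMap k Λ ∧
      (∀ x : X.carrier, Nonempty (FundamentalGroup X.carrier x ≃* Λ)) ∧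
      ∃ e : pslQuotient Λ ≅ X, ∀ τ : ℍ, e.hom.toFun (Quotient.mk (orbitRel Λ ℍ) τ) = k τ :=
  exists_pslQuotient_iso_of_nonabelian_fundamentalGroup X simplyConnectedUniformization_holds x₀ hπ

/-- **The Möbius deck group of a hyperbolic Riemann surface with non-abelian `π₁` is non-abelian** —
UNCONDITIONAL form of `HolRS.exists_pslQuotient_iso_nonabelian_of_nonabelian_fundamentalGroup`.
[cite: FarkasKra1992, IV.5.5–IV.5.6] -/
theorem exists_pslQuotient_iso_nonabelian_of_nonabelian_fundamentalGroup_unconditional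
    [SecondCountableTopology X.carrier] (x₀ : X.carrier)
    (hπ : ∃ a b : FundamentalGroup X.carrier x₀, a * b ≠ b * a) :
    ∃ (Λ : Subgroup PSL2R) (_ : ProperlyDiscontinuousSMul Λ ℍ) (_ : IsCancelSMul Λ ℍ),
      (∃ a b : Λ, a * b ≠ b * a) ∧ Nonempty (pslQuotient Λ ≅ X) :=
  exists_pslQuotient_iso_nonabelian_of_nonabelian_fundamentalGroup X
    simplyConnectedUniformization_holds x₀ hπ

/-- ★★ **[AbsTopIII] Prop. 4.2 (i) and `Cor_4_5_full` at EVERY compact second-countable Riemann surface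
whose fundamental group is an orientable surface group** (every compact hyperbolic `X` of genus `≥ 2`)
— UNCONDITIONAL form of
`HolRS.isIdRigid_EA_and_cor_4_5_full_mapsTo_of_isOrientableSurfaceGroup_fundamentalGroup`: the
geometric `EA` of «objects of `HolRS` mapping to `X`» is id-rigid and every printed clause of Cor. 4.5
holds for its archimedean log-Frobenius data — no named fact, no residual hypothesis.
[cite: MochizukiAbsTopIII2015, Proposition 4.2 (i) proof p.106]
[cite: MochizukiAbsTopIII2015, Corollary 4.5 pp.107–109] [cite: FarkasKra1992, IV.5.5–IV.5.6] -/
theorem isIdRigid_EA_and_cor_4_5_full_mapsTo_of_isOrientableSurfaceGroup_fundamentalGroup_unconditional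
    [CompactSpace X.carrier] [SecondCountableTopology X.carrier] (x₀ : X.carrier)
    (hπ : IsOrientableSurfaceGroup (FundamentalGroup X.carrier x₀)) :
    IsIdRigid (geometricAutHolFieldFunctor fun Y : HolRS => Nonempty (Y ⟶ X)).EA ∧
      AbsTopIII.Cor_4_5_full
        (archLogFrobeniusData (geometricAutHolFieldFunctor fun Y : HolRS => Nonempty (Y ⟶ X)))
        (archTelecoreData (geometricAutHolFieldFunctor fun Y : HolRS => Nonempty (Y ⟶ X))) :=
  isIdRigid_EA_and_cor_4_5_full_mapsTo_of_isOrientableSurfaceGroup_fundamentalGroup X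
    simplyConnectedUniformization_holds x₀ hπ

end HolRS

end Literature.AnabelianGeometry.AbsoluteAnabelian

end
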